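import Summits.QuantumFields.BalabanUV.Beta.FP.TorusCombNestedBasis

/-!
# `BalabanUV.Beta.FP.TorusCompositeObjects` — road «FP» for binder row D1, ROUTE T, the OWNER's SPEC-27 «THE (j, m) TORUS CALL FOR m ≥ 2» (memo
# `N2B-DESIGN.md` §27, journal [D1P3-G19-SPEC-27], ask W-FP-19-12 → leaf-06): **THE COMB TOWER — the m-fold composite's typed torus objects by
# recursion on the depth, with the TOP (coarsest) torus as the varying parameter** ([our object] bookkeeping; design D-d1leaf06g20-1)

WHAT.  The graded torus call `FP/NestedStepLawTorusTransportedGraded` (#12, p326039) is the case `m = 1`: ONE step on `fine Lc M′` (small comb `τ₁`),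
ONE step above on `M′` (comb `τ₂`), the one-shot big comb of ratio `Lc·Lc` sorted `ρ₂ ⊕ ρ₁` by `TorusCombNestedBasis.resBigEquiv`.  For `m ≥ 2` the FINE
system is the m-fold composite over a TOWER of tori, sliced by the NESTED comb slice; the one-shot slice is the big comb of ratio `Lc^{m+1}` on the finest
torus.  This file types the objects ONCE, by structural recursion on the depth `n` with every recursive call AT the next finer top torus `fine Lc M`
(«push-inside»), so that EVERY level's one-step pair is syntactically `(M″, fine Lc M″)` and every landed one-step object∕theorem instantiates with no cast:
`towerTorus Lc M n` (finest torus of `n+1` levels; `towerTorus_apply : … μ = Lc ^ n * M μ`); `Qstep` ((B)'s `hQ₁₀` shape), `combF` (`hτ` shape),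
`compRows … n` (the n-fold averaging, `compRows … (n+1) = Qstep M (lev 1) (rs 1) * compRows (fine Lc M) … n` by `rfl`); the nested parameter TYPE
`NParam Lc M rs n` (TOP FIRST: `NParam … (n+1) = Res (toSite (rs 0)) Lc M ⊕ NParam (fine Lc M) (rs ∘ succ) n` — the door's `ρ₂ ⊕ ρ₁` at every level;
`Fintype ∕ DecidableEq` by the same recursion); `nestedSlice … n` (`nestedSlice … (n+1) = fromRows (combF M (rs 0) * compRows … (n+1)) (nestedSlice (fine Lc M) … n)`
— leaf-05 g28's requested interface, W-7 l.42615, BY `rfl`); `bigRatio Lc n = Lc^{n+1}`, `bigRoot Lc rs n`; `resCongr ∕ pboxCongr` (SITE-PRESERVING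
equivalences along an equality of tori — the only bridge between the iterate `towerTorus Lc M (n+1)` and the single-shot `fine (bigRatio Lc n) M`, equal
by `Nat.mul` associativity but not definitionally); the SORTING `towerEquiv : Res (bigRoot …) (bigRatio …) (towerTorus …) ≃ NParam …` by recursion over
`resBigEquiv`; `bigP` (the (B) `hP` shape with `resBigEquiv ↦ towerEquiv`); `towerGen` (`fromCols D_top W₀^{lower}`, (B)'s `fromCols D₂ D₁`).  AT `n = 1`
EVERYTHING IS (B) ON THE NOSE (`compRows_one`, `nestedSlice_one`, `towerEquiv_one_symm_apply`, `bigP_one`, `towerGen_one` — `rfl`∕`Matrix.mul_one`).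
NOT here: (EFF-m) (leaf-05), (COV-m)(WARD-m)(T-β-m) rows (leaf-02), the composite call (OWNER); (SLICE-m) letters = leaf-06's NEXT file.

HONEST DEPENDENCY (page 1, mandatory): continuum YM on T⁴ ⇐ BetaPertH ∧ nine spine estimates (0/9 proved); BetaPertH ⇐ (D1) ∧ (D4) ∧ CAP+tail;
G-an2-4 gates asym, D1 and NE2/3/4.  HONEST FRAMING (cell contract, verbatim): «discharging `BetaPertH` makes Bałaban's UV stability UNCONDITIONAL —
a real constructive-QFT result; it is NOT the continuum limit and NOT the Clay problem.»  ABSOLUTE RULE (cell charter, verbatim): «No internally-minted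
statement may enter as a cited fact. Every hypothesis is either kernel-proved in this package or a verbatim quotation of a PUBLISHED theorem with page
reference. The manuscript(s) under audit are NOT citable for their own disputed steps — they are the thing under adjudication; programme-internal
(2001/route/tribunal) claims are never citable.»  [our object] bookkeeping + [folklore] index arithmetic only; no `def … : Prop`, nothing cited, 0 sorry;
0 estimates; 0∕4 row-D1 binders; NOT (T-ID), NOT SDF, NOT D1, NOT BetaPertH, NOT continuum, NOT Clay.  D1 formalisation swarm LEAF PROVER 06
(b2b-balaban-beta-d1-formalise-leaf-06 gen 20), 2026-08-22.  No existing file touched.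
-/

noncomputable section

namespace Summit.QuantumFields.BalabanUV.Beta.FP.TorusCompositeObjects

open Matrix
open Literature.MathematicalPhysics.QuantumFieldTheory.Balaban1983to89
open Literature.MathematicalPhysics.QuantumFieldTheory.Balaban1983to89.Beta
open B5Prop11Plancherel (fine)
open B6Lemma24Torus (pbox mem_pbox)
open AffineAveraging (Site toSite)
open OneStepResolventKernel (Fib)
open Summit.QuantumFields.BalabanUV.Beta.BorderedHessian (bhKStepAt)
open Summit.QuantumFields.BalabanUV.Beta.FP.KernelPeriodisationFib (Idx perF)
open Summit.QuantumFields.BalabanUV.Beta.FP.TorusGaugeCovariance (tgrad)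
open Summit.QuantumFields.BalabanUV.Beta.FP.TorusGaugeCovarianceCoarse (coarsePt tgradBlock)
open Summit.QuantumFields.BalabanUV.Beta.FP.TorusCombForest (rootOf)
open Summit.QuantumFields.BalabanUV.Beta.FP.TorusCombRows (Res combRowsT)
open Summit.QuantumFields.BalabanUV.Beta.FP.TorusCombNestedBasis (resBigEquiv bigRoot_bounds)

variable {d : ℕ}

/-! ## §1 The tower of tori, the big-comb ratio and root offset -/

section Tower

variable (Lc : ℕ)

/-- [our object — bookkeeping] **THE FINEST TORUS OF THE `n+1`-LEVEL TOWER WITH TOP `M`**: `M, fine Lc M, fine Lc (fine Lc M), …` — recursion with the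
recursive call AT `fine Lc M` («push-inside»), so that `towerTorus Lc M (n+1)` is LITERALLY `towerTorus Lc (fine Lc M) n`. -/
def towerTorus : (Fin (d + 1) → ℕ) → ℕ → (Fin (d + 1) → ℕ)
  | M, 0 => M
  | M, n + 1 => towerTorus (fine Lc M) n

/-- unfolding, depth `0`. -/
@[simp] theorem towerTorus_zero (M : Fin (d + 1) → ℕ) : towerTorus Lc M 0 = M := rfl

/-- unfolding, depth `n+1` (the recursive call at the next finer top torus). -/
@[simp] theorem towerTorus_succ (M : Fin (d + 1) → ℕ) (n : ℕ) : towerTorus Lc M (n + 1) = towerTorus Lc (fine Lc M) n := rfl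

/-- [folklore] the finest torus of `n+1` levels has moduli `Lc^n · M`. -/
theorem towerTorus_apply (M : Fin (d + 1) → ℕ) (n : ℕ) (μ : Fin (d + 1)) : towerTorus Lc M n μ = Lc ^ n * M μ := by
  induction n generalizing M with
  | zero => simp [towerTorus]
  | succ n ih => rw [towerTorus_succ, ih (fine Lc M)]; simp only [fine]; ring

/-- [folklore] positivity of the tower moduli. -/
instance towerTorus_neZero [NeZero Lc] (M : Fin (d + 1) → ℕ) [∀ μ, NeZero (M μ)] (n : ℕ) (μ : Fin (d + 1)) :
    NeZero (towerTorus Lc M n μ) := by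
  rw [towerTorus_apply]; exact ⟨mul_ne_zero (pow_ne_zero _ (NeZero.ne Lc)) (NeZero.ne (M μ))⟩

/-- [our object — bookkeeping] **THE BIG-COMB RATIO OF THE `n+1`-LEVEL TOWER**, `Lc^{n+1}`, spelled `bigRatio n * Lc` at the successor so that
`TorusCombNestedBasis.resBigEquiv (N := bigRatio Lc n) (N₂ := Lc)` applies with no arithmetic. -/
def bigRatio : ℕ → ℕ
  | 0 => Lc
  | n + 1 => bigRatio n * Lc

/-- unfolding, depth `0`. -/
@[simp] theorem bigRatio_zero : bigRatio Lc 0 = Lc := rfl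

/-- unfolding, depth `n+1`. -/
@[simp] theorem bigRatio_succ (n : ℕ) : bigRatio Lc (n + 1) = bigRatio Lc n * Lc := rfl

/-- [folklore] `bigRatio Lc n = Lc^{n+1}`. -/
theorem bigRatio_eq_pow (n : ℕ) : bigRatio Lc n = Lc ^ (n + 1) := by
  induction n with
  | zero => simp
  | succ n ih => rw [bigRatio_succ, ih]; ring

/-- [folklore] positivity of the big ratio. -/
theorem bigRatio_pos (hLc : 0 < Lc) (n : ℕ) : 0 < bigRatio Lc n := by
  rw [bigRatio_eq_pow]; exact pow_pos hLc _

/-- [folklore] **THE ONE LOCATED NON-DEFEQ, AS A PROPOSITIONAL EQUALITY**: the iterate `towerTorus Lc M (n+1)` IS the single-shot fine torus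
`fine (bigRatio Lc n) M` (`Lc·(Lc·(…·M)) = Lc^{n+1}·M` by associativity). -/
theorem towerTorus_succ_eq_fine (M : Fin (d + 1) → ℕ) (n : ℕ) : towerTorus Lc M (n + 1) = fine (bigRatio Lc n) M := by
  funext μ
  rw [towerTorus_apply, bigRatio_eq_pow]

/-- the same one level down: `towerTorus Lc (fine Lc M) n = fine (bigRatio Lc n) M`. -/
theorem towerTorus_fine_eq_fine (M : Fin (d + 1) → ℕ) (n : ℕ) : towerTorus Lc (fine Lc M) n = fine (bigRatio Lc n) M :=
  towerTorus_succ_eq_fine Lc M n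

/-- [our object — bookkeeping] **THE BIG-COMB ROOT OFFSET OF THE `n+1`-LEVEL TOWER** from the per-level in-block roots `rs k ∈ box Lc` (`rs 0` the top's):
`bigRoot (n+1) = bigRatio n • toSite (rs 0) + bigRoot (rs ∘ succ) n` — the `(N : ℤ) • ρ₂ + ρ` shape of `resBigEquiv`. -/
def bigRoot : (ℕ → (Fin (d + 1) → ℕ)) → ℕ → Site (d + 1)
  | rs, 0 => toSite (rs 0)
  | rs, n + 1 => (bigRatio Lc n : ℤ) • toSite (rs 0) + bigRoot (fun k => rs (k + 1)) n

/-- unfolding, depth `0`. -/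
@[simp] theorem bigRoot_zero (rs : ℕ → (Fin (d + 1) → ℕ)) : bigRoot Lc rs 0 = toSite (rs 0) := rfl

/-- unfolding, depth `n+1`. -/
@[simp] theorem bigRoot_succ (rs : ℕ → (Fin (d + 1) → ℕ)) (n : ℕ) :
    bigRoot Lc rs (n + 1) = (bigRatio Lc n : ℤ) • toSite (rs 0) + bigRoot Lc (fun k => rs (k + 1)) n := rfl

/-- [folklore] the big root offset lies in the big block: `0 ≤ bigRoot i < bigRatio n` (from `0 ≤ toSite (rs k) i < Lc` at every level). -/
theorem bigRoot_range (hLc : 0 < Lc) :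
    ∀ (n : ℕ) (rs : ℕ → (Fin (d + 1) → ℕ)), (∀ k i, 0 ≤ toSite (rs k) i ∧ toSite (rs k) i < (Lc : ℤ)) →
      ∀ i, 0 ≤ bigRoot Lc rs n i ∧ bigRoot Lc rs n i < ((bigRatio Lc n : ℕ) : ℤ)
  | 0, rs, hrs, i => by simpa using hrs 0 i
  | n + 1, rs, hrs, i => by
    rw [bigRoot_succ, bigRatio_succ]
    exact bigRoot_bounds (bigRatio_pos Lc hLc n) (bigRoot_range hLc n (fun k => rs (k + 1)) (fun k => hrs (k + 1))) (hrs 0) i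

end Tower

/-! ## §2 A site-preserving equivalence of residual parameter types along an equality of tori -/

section Congr

variable {ρ : Site (d + 1)} {K : ℕ}

/-- [our object — bookkeeping] **`Res ρ K A ≃ Res ρ K A′` ALONG `A = A′`, PRESERVING THE SITE BY `rfl`** (no `cast` on data: the membership proof
is transported, the site is kept). -/
def resCongr {A A' : Fin (d + 1) → ℕ} (h : A = A') : Res ρ K A ≃ Res ρ K A' where
  toFun s := ⟨⟨s.site, h ▸ s.mem⟩, s.not_root⟩
  invFun s := ⟨⟨s.site, h.symm ▸ s.mem⟩, s.not_root⟩
  left_inv _ := rfl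
  right_inv _ := rfl

/-- the site is preserved. -/
@[simp] theorem resCongr_site {A A' : Fin (d + 1) → ℕ} (h : A = A') (s : Res ρ K A) : (resCongr h s).site = s.site := rfl

/-- the site is preserved by the inverse. -/
@[simp] theorem resCongr_symm_site {A A' : Fin (d + 1) → ℕ} (h : A = A') (s : Res ρ K A') : ((resCongr h).symm s).site = s.site := rfl

/-- [our object — bookkeeping] **`↥(pbox A) ≃ ↥(pbox A′)` ALONG `A = A′`, PRESERVING THE SITE BY `rfl`.** -/
def pboxCongr {A A' : Fin (d + 1) → ℕ} (h : A = A') : ↥(pbox A) ≃ ↥(pbox A') where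
  toFun x := ⟨x.1, h ▸ x.2⟩
  invFun x := ⟨x.1, h.symm ▸ x.2⟩
  left_inv _ := rfl
  right_inv _ := rfl

/-- the site is preserved. -/
@[simp] theorem pboxCongr_coe {A A' : Fin (d + 1) → ℕ} (h : A = A') (x : ↥(pbox A)) :
    ((pboxCongr h x : ↥(pbox A')) : Site (d + 1)) = (x : Site (d + 1)) := rfl

end Congr

/-! ## §3 The one-step averaging rows, the composite averaging, the nested parameter type and the nested comb slice -/

section Objects

variable (Lc : ℕ) [NeZero Lc]

/-- [our object — bookkeeping] **THE ONE-STEP AVERAGING ROWS BETWEEN `M` AND `fine Lc M`** at level `ℓ` with in-block root `r` — EXACTLY the shape of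
(B)'s `hQ₁₀` (`NestedStepLawTorusInstance` ∕ `…TransportedGraded`): rows = the coarse multiplier slots read at the representative fine points
`coarsePt`, columns = the fine field slots, entries = the periodised level-`ℓ` step kernel. -/
def Qstep (M : Fin (d + 1) → ℕ) [∀ μ, NeZero (M μ)] (ℓ : ℕ) (r : Fin (d + 1) → ℕ) :
    Matrix (↥(pbox M) × Fin (d + 1)) (↥(pbox (fine Lc M)) × Fin (d + 1)) ℝ :=
  (perF (fine Lc M) (bhKStepAt d (toSite r) Lc ℓ)).submatrix
    (fun a : ↥(pbox M) × Fin (d + 1) => ((coarsePt M Lc a.1, Sum.inr a.2) : Idx (fine Lc M) (Fib d)))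
    (fun b : ↥(pbox (fine Lc M)) × Fin (d + 1) => ((b.1, Sum.inl b.2) : Idx (fine Lc M) (Fib d)))

/-- [our object — bookkeeping] **THE COMB SLICE ROWS OF ONE LEVEL ON THE FIELD SLOTS** — EXACTLY the shape of (B)'s `hτ₁ ∕ hτ₂`. -/
def combF (M : Fin (d + 1) → ℕ) (r : Fin (d + 1) → ℕ) : Matrix (Res (toSite r) Lc M) (↥(pbox M) × Fin (d + 1)) ℝ :=
  (combRowsT (toSite r) Lc M).submatrix id (fun b : ↥(pbox M) × Fin (d + 1) => ((b.1, Sum.inl b.2) : Idx M (Fib d)))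

/-- [our object — bookkeeping] **THE `n`-FOLD COMPOSITE AVERAGING** from the finest torus `towerTorus Lc M n` to the top `M`: `1` at depth `0`,
`Qstep M (lev 1) (rs 1) * compRows (fine Lc M) (lev ∘ succ) (rs ∘ succ) n` at depth `n+1` (the step between `M` and `fine Lc M` uses the FINER level's
index `lev 1` and root `rs 1`, as (B)'s `hQ₁₀` uses the fine level's `j` and `r`).  CONVENTION (OWNER W-FP-19-16 (2)): `lev rs` are indexed FROM THE
TOP — `lev k` ∕ `rs k` are the level and the in-block comb root of the `k`-th torus `towerTorus Lc M k` below `M`; THE RECORD TAKES `lev k = j + n − k`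
(top `M` at level `j + n`, finest at level `j`).  READING FOR THE DOOR at the depth-`(n+1)` literal over `M`: `Q₁₀ := compRows Lc M lev rs (n+1)`,
`τ₂ := combF Lc M (rs 0)`, `τ₁ := nestedSlice Lc (fine Lc M) (lev ∘ succ) (rs ∘ succ) n`, `P := bigP Lc M rs hrs (n+1)` (rows `ρ₂ ⊕ ρ₁ =
Res (toSite (rs 0)) Lc M ⊕ NParam Lc (fine Lc M) (rs ∘ succ) n`), and the door's internal `fromRows (τ₂ * Q₁₀) τ₁` IS `nestedSlice Lc M lev rs (n+1)`
(`nestedSlice_succ`, `rfl`). -/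
def compRows : (M : Fin (d + 1) → ℕ) → [∀ μ, NeZero (M μ)] → (ℕ → ℕ) → (ℕ → (Fin (d + 1) → ℕ)) → (n : ℕ) →
    Matrix (↥(pbox M) × Fin (d + 1)) (↥(pbox (towerTorus Lc M n)) × Fin (d + 1)) ℝ
  | M, _, _, _, 0 => (1 : Matrix (↥(pbox M) × Fin (d + 1)) (↥(pbox M) × Fin (d + 1)) ℝ)
  | M, _, lev, rs, n + 1 => Qstep Lc M (lev 1) (rs 1) * compRows (fine Lc M) (fun k => lev (k + 1)) (fun k => rs (k + 1)) n

/-- unfolding, depth `0`. -/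
@[simp] theorem compRows_zero (M : Fin (d + 1) → ℕ) [∀ μ, NeZero (M μ)] (lev : ℕ → ℕ) (rs : ℕ → (Fin (d + 1) → ℕ)) :
    compRows Lc M lev rs 0 = (1 : Matrix (↥(pbox M) × Fin (d + 1)) (↥(pbox M) × Fin (d + 1)) ℝ) := rfl

/-- unfolding, depth `n+1` — TOP-PEEL BY `rfl`. -/
theorem compRows_succ (M : Fin (d + 1) → ℕ) [∀ μ, NeZero (M μ)] (lev : ℕ → ℕ) (rs : ℕ → (Fin (d + 1) → ℕ)) (n : ℕ) :
    compRows Lc M lev rs (n + 1) = Qstep Lc M (lev 1) (rs 1) * compRows Lc (fine Lc M) (fun k => lev (k + 1)) (fun k => rs (k + 1)) n := rfl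

/-- the one-fold composite is the one-step averaging (B)'s `Q₁₀`. -/
theorem compRows_one (M : Fin (d + 1) → ℕ) [∀ μ, NeZero (M μ)] (lev : ℕ → ℕ) (rs : ℕ → (Fin (d + 1) → ℕ)) :
    compRows Lc M lev rs 1 = Qstep Lc M (lev 1) (rs 1) :=
  Matrix.mul_one _

/-- [our object — bookkeeping] **THE NESTED PARAMETER TYPE OF THE `n+1`-LEVEL TOWER, TOP FIRST**: the residual parameters of the comb on `M`, then
those of the tower below (`fine Lc M`, depth `n`).  At depth `0`: the top comb alone. -/
def NParam : (M : Fin (d + 1) → ℕ) → (ℕ → (Fin (d + 1) → ℕ)) → ℕ → Type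
  | M, rs, 0 => Res (toSite (rs 0)) Lc M
  | M, rs, n + 1 => Res (toSite (rs 0)) Lc M ⊕ NParam (fine Lc M) (fun k => rs (k + 1)) n

/-- [folklore] finitely many nested parameters. -/
instance instFintypeNParam : (M : Fin (d + 1) → ℕ) → (rs : ℕ → (Fin (d + 1) → ℕ)) → (n : ℕ) → Fintype (NParam Lc M rs n)
  | M, rs, 0 => inferInstanceAs (Fintype (Res (toSite (rs 0)) Lc M))
  | M, rs, n + 1 =>
    haveI := instFintypeNParam (fine Lc M) (fun k => rs (k + 1)) n
    inferInstanceAs (Fintype (Res (toSite (rs 0)) Lc M ⊕ NParam Lc (fine Lc M) (fun k => rs (k + 1)) n))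

/-- [folklore] decidable equality of nested parameters. -/
instance instDecidableEqNParam : (M : Fin (d + 1) → ℕ) → (rs : ℕ → (Fin (d + 1) → ℕ)) → (n : ℕ) → DecidableEq (NParam Lc M rs n)
  | M, rs, 0 => inferInstanceAs (DecidableEq (Res (toSite (rs 0)) Lc M))
  | M, rs, n + 1 =>
    haveI := instDecidableEqNParam (fine Lc M) (fun k => rs (k + 1)) n
    inferInstanceAs (DecidableEq (Res (toSite (rs 0)) Lc M ⊕ NParam Lc (fine Lc M) (fun k => rs (k + 1)) n))

/-- [our object — bookkeeping] **THE NESTED COMB SLICE OF THE `n+1`-LEVEL TOWER ON THE FINEST FIELDS**: at depth `0` the comb rows of `M`; at depth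
`n+1` the top comb rows composed with the full composite averaging, STACKED OVER the nested slice of the tower below — the door's
`fromRows (τ₂ * Q₁₀) τ₁` at every level. -/
def nestedSlice : (M : Fin (d + 1) → ℕ) → [∀ μ, NeZero (M μ)] → (lev : ℕ → ℕ) → (rs : ℕ → (Fin (d + 1) → ℕ)) → (n : ℕ) →
    Matrix (NParam Lc M rs n) (↥(pbox (towerTorus Lc M n)) × Fin (d + 1)) ℝ
  | M, _, _, rs, 0 => combF Lc M (rs 0)
  | M, _, lev, rs, n + 1 =>
    Matrix.fromRows (combF Lc M (rs 0) * compRows Lc M lev rs (n + 1))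
      (nestedSlice (fine Lc M) (fun k => lev (k + 1)) (fun k => rs (k + 1)) n)

/-- unfolding, depth `0`. -/
@[simp] theorem nestedSlice_zero (M : Fin (d + 1) → ℕ) [∀ μ, NeZero (M μ)] (lev : ℕ → ℕ) (rs : ℕ → (Fin (d + 1) → ℕ)) :
    nestedSlice Lc M lev rs 0 = combF Lc M (rs 0) := rfl

/-- **leaf-05 g28's interface (W-7), BY `rfl`**: `nestedSlice … (n+1) = fromRows (τ_top * compRows … (n+1)) (nestedSlice (tower below) … n)`. -/
theorem nestedSlice_succ (M : Fin (d + 1) → ℕ) [∀ μ, NeZero (M μ)] (lev : ℕ → ℕ) (rs : ℕ → (Fin (d + 1) → ℕ)) (n : ℕ) :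
    nestedSlice Lc M lev rs (n + 1)
      = Matrix.fromRows (combF Lc M (rs 0) * compRows Lc M lev rs (n + 1))
          (nestedSlice Lc (fine Lc M) (fun k => lev (k + 1)) (fun k => rs (k + 1)) n) := rfl

/-- the one-fold nested slice is (B)'s `fromRows (τ₂ * Q₁₀) τ₁`. -/
theorem nestedSlice_one (M : Fin (d + 1) → ℕ) [∀ μ, NeZero (M μ)] (lev : ℕ → ℕ) (rs : ℕ → (Fin (d + 1) → ℕ)) :
    nestedSlice Lc M lev rs 1 = Matrix.fromRows (combF Lc M (rs 0) * Qstep Lc M (lev 1) (rs 1)) (combF Lc (fine Lc M) (rs 1)) := by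
  rw [nestedSlice_succ, compRows_one]; rfl

end Objects

/-! ## §4 The sorting of the one-shot big comb's residual parameters into the nested parameter type -/

section Sorting

variable (Lc : ℕ) [NeZero Lc]

/-- [our object — bookkeeping] **THE SORTING `Res (bigRoot) (bigRatio) (finest) ≃ NParam`, BY RECURSION OVER `resBigEquiv`**: at depth `0` the
identity; at depth `n+1`: move to the single-shot presentation `fine (bigRatio Lc n) M` of the finest torus (`resCongr`), split off the TOP comb by
`resBigEquiv (N := bigRatio Lc n) (N₂ := Lc)`, and sort the lower big comb recursively. -/
def towerEquiv :
    (M : Fin (d + 1) → ℕ) → (rs : ℕ → (Fin (d + 1) → ℕ)) → (hrs : ∀ k i, 0 ≤ toSite (rs k) i ∧ toSite (rs k) i < (Lc : ℤ)) → (n : ℕ) →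
      Res (bigRoot Lc rs n) (bigRatio Lc n) (towerTorus Lc M n) ≃ NParam Lc M rs n
  | _, _, _, 0 => Equiv.refl _
  | M, rs, hrs, n + 1 =>
    (resCongr (towerTorus_succ_eq_fine Lc M n)).trans
      ((resBigEquiv (bigRatio Lc n) Lc (bigRoot Lc (fun k => rs (k + 1)) n) (toSite (rs 0)) M
          (bigRatio_pos Lc (Nat.pos_of_ne_zero (NeZero.ne Lc)) n)
          (bigRoot_range Lc (Nat.pos_of_ne_zero (NeZero.ne Lc)) n (fun k => rs (k + 1)) (fun k => hrs (k + 1)))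
          (Nat.pos_of_ne_zero (NeZero.ne Lc)) (hrs 0)).trans
        (Equiv.sumCongr (Equiv.refl _)
          ((resCongr (towerTorus_fine_eq_fine Lc M n).symm).trans (towerEquiv (fine Lc M) (fun k => rs (k + 1)) (fun k => hrs (k + 1)) n))))

/-- unfolding, depth `0`: the identity. -/
@[simp] theorem towerEquiv_zero (M : Fin (d + 1) → ℕ) (rs : ℕ → (Fin (d + 1) → ℕ))
    (hrs : ∀ k i, 0 ≤ toSite (rs k) i ∧ toSite (rs k) i < (Lc : ℤ)) :
    towerEquiv Lc M rs hrs 0 = Equiv.refl _ := rfl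

/-- [folklore] the sorting sends a TOP residual parameter `t̄` back to the big-block site `bigRatio n • t̄ + bigRoot (lower)` (by `rfl`, as
`resBigEquiv_symm_inl_site`). -/
@[simp] theorem towerEquiv_symm_inl_site (M : Fin (d + 1) → ℕ) (rs : ℕ → (Fin (d + 1) → ℕ))
    (hrs : ∀ k i, 0 ≤ toSite (rs k) i ∧ toSite (rs k) i < (Lc : ℤ)) (n : ℕ) (t : Res (toSite (rs 0)) Lc M) :
    ((towerEquiv Lc M rs hrs (n + 1)).symm (Sum.inl t)).site = (bigRatio Lc n : ℤ) • t.site + bigRoot Lc (fun k => rs (k + 1)) n := rfl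

/-- [folklore] … and a LOWER nested parameter to the site the lower sorting gives it (by `rfl`). -/
@[simp] theorem towerEquiv_symm_inr_site (M : Fin (d + 1) → ℕ) (rs : ℕ → (Fin (d + 1) → ℕ))
    (hrs : ∀ k i, 0 ≤ toSite (rs k) i ∧ toSite (rs k) i < (Lc : ℤ)) (n : ℕ) (x : NParam Lc (fine Lc M) (fun k => rs (k + 1)) n) :
    ((towerEquiv Lc M rs hrs (n + 1)).symm (Sum.inr x)).site
      = ((towerEquiv Lc (fine Lc M) (fun k => rs (k + 1)) (fun k => hrs (k + 1)) n).symm x).site := rfl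

/-- **(B) IS THE CASE `n = 1` ON THE NOSE**: the depth-1 sorting is `TorusCombNestedBasis.resBigEquiv Lc Lc (toSite (rs 1)) (toSite (rs 0)) M` as a map
(the two `resCongr`s are along `rfl`-equalities of tori and the lower sorting is the identity). -/
theorem towerEquiv_one_symm_apply (M : Fin (d + 1) → ℕ) (rs : ℕ → (Fin (d + 1) → ℕ))
    (hrs : ∀ k i, 0 ≤ toSite (rs k) i ∧ toSite (rs k) i < (Lc : ℤ))
    (x : Res (toSite (rs 0)) Lc M ⊕ Res (toSite (rs 1)) Lc (fine Lc M)) :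
    (towerEquiv Lc M rs hrs 1).symm x
      = (resBigEquiv Lc Lc (toSite (rs 1)) (toSite (rs 0)) M (Nat.pos_of_ne_zero (NeZero.ne Lc)) (hrs 1)
          (Nat.pos_of_ne_zero (NeZero.ne Lc)) (hrs 0)).symm x := by
  cases x <;> rfl

end Sorting

/-! ## §5 The one-shot slice of the `(n+1)`-level literal: the big comb rows re-indexed by the nested parameter type -/

section OneShot

variable (Lc : ℕ) [NeZero Lc]

/-- [our object — bookkeeping] **THE ONE-SHOT COMB SLICE `P^{(n+1)}`**: the rows of the big comb (ratio `bigRatio Lc n`, root `bigRoot Lc rs n`) on the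
finest torus, on the field slots, re-indexed by `towerEquiv` — (B)'s `hP` shape with `resBigEquiv ↦ towerEquiv`; its row blocks are the door's `ρ₂ ⊕ ρ₁`
(top comb ⊕ lower nested parameters). -/
def bigP (M : Fin (d + 1) → ℕ) (rs : ℕ → (Fin (d + 1) → ℕ)) (hrs : ∀ k i, 0 ≤ toSite (rs k) i ∧ toSite (rs k) i < (Lc : ℤ)) (n : ℕ) :
    Matrix (NParam Lc M rs n) (↥(pbox (towerTorus Lc M n)) × Fin (d + 1)) ℝ :=
  (combRowsT (bigRoot Lc rs n) (bigRatio Lc n) (towerTorus Lc M n)).submatrix (towerEquiv Lc M rs hrs n).symm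
    (fun b : ↥(pbox (towerTorus Lc M n)) × Fin (d + 1) => ((b.1, Sum.inl b.2) : Idx (towerTorus Lc M n) (Fib d)))

/-- depth `0`: the one-level literal's one-shot slice is the top comb itself. -/
theorem bigP_zero (M : Fin (d + 1) → ℕ) (rs : ℕ → (Fin (d + 1) → ℕ)) (hrs : ∀ k i, 0 ≤ toSite (rs k) i ∧ toSite (rs k) i < (Lc : ℤ)) :
    bigP Lc M rs hrs 0 = combF Lc M (rs 0) := rfl

/-- **(B) IS THE CASE `n = 1` ON THE NOSE**: `bigP … 1` is (B)'s `hP` right-hand side character for character (`r′ := rs 0` the top root, `r := rs 1`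
the fine root; the positivity ∕ range proof arguments differ only by proof irrelevance). -/
theorem bigP_one (M : Fin (d + 1) → ℕ) [∀ μ, NeZero (M μ)] (rs : ℕ → (Fin (d + 1) → ℕ))
    (hrs : ∀ k i, 0 ≤ toSite (rs k) i ∧ toSite (rs k) i < (Lc : ℤ)) :
    bigP Lc M rs hrs 1
      = (combRowsT ((Lc : ℤ) • toSite (rs 0) + toSite (rs 1)) (Lc * Lc) (fine Lc M)).submatrix
          (resBigEquiv Lc Lc (toSite (rs 1)) (toSite (rs 0)) M (Nat.pos_of_ne_zero (NeZero.ne Lc)) (hrs 1)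
            (Nat.pos_of_ne_zero (NeZero.ne Lc)) (hrs 0)).symm
          (fun b : ↥(pbox (fine Lc M)) × Fin (d + 1) => ((b.1, Sum.inl b.2) : Idx (fine Lc M) (Fib d))) := by
  ext x b
  simp only [bigP, Matrix.submatrix_apply, towerEquiv_one_symm_apply]
  rfl

end OneShot

/-! ## §6 The tower generator matrix: the gauge modes of every level as fields of the finest torus, columns indexed `NParam` -/

section Generators

variable (Lc : ℕ) [NeZero Lc]

/-- [our object — bookkeeping] **THE TOWER GENERATOR MATRIX `W₀^{(n)}`** on the finest fields, columns = the nested parameters: at depth `0` the torus's own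
gauge modes at its residual parameters ((B)'s `hD₁` shape); at depth `n+1` the TOP level's `bigRatio n`-block-constant modes (`tgradBlock M (bigRatio Lc n)`,
(B)'s `hD₂` shape, rows moved to the iterate torus by `pboxCongr`) placed LEFT of the lower tower's generators — `fromCols D_top W₀^{lower}` = the door's
`fromCols D₂ D₁` at every level. -/
def towerGen : (M : Fin (d + 1) → ℕ) → [∀ μ, NeZero (M μ)] → (rs : ℕ → (Fin (d + 1) → ℕ)) → (n : ℕ) →
    Matrix (↥(pbox (towerTorus Lc M n)) × Fin (d + 1)) (NParam Lc M rs n) ℝ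
  | M, _, rs, 0 => (tgrad M).submatrix (fun b : ↥(pbox M) × Fin (d + 1) => ((b.1, Sum.inl b.2) : Idx M (Fib d)))
      (Subtype.val : Res (toSite (rs 0)) Lc M → ↥(pbox M))
  | M, _, rs, n + 1 => Matrix.fromCols
      ((tgradBlock M (bigRatio Lc n)).submatrix
        (fun b : ↥(pbox (towerTorus Lc (fine Lc M) n)) × Fin (d + 1) =>
          ((pboxCongr (towerTorus_fine_eq_fine Lc M n) b.1, Sum.inl b.2) : Idx (fine (bigRatio Lc n) M) (Fib d)))
        (Subtype.val : Res (toSite (rs 0)) Lc M → ↥(pbox M)))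
      (towerGen (fine Lc M) (fun k => rs (k + 1)) n)

/-- unfolding, depth `0` — (B)'s `hD₁` shape. -/
theorem towerGen_zero (M : Fin (d + 1) → ℕ) [∀ μ, NeZero (M μ)] (rs : ℕ → (Fin (d + 1) → ℕ)) :
    towerGen Lc M rs 0 = (tgrad M).submatrix (fun b : ↥(pbox M) × Fin (d + 1) => ((b.1, Sum.inl b.2) : Idx M (Fib d)))
      (Subtype.val : Res (toSite (rs 0)) Lc M → ↥(pbox M)) := rfl

/-- unfolding, depth `n+1` — TOP-PEEL BY `rfl`: `W₀^{(n+1)} = fromCols D_top W₀^{(n)}(tower below)`. -/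
theorem towerGen_succ (M : Fin (d + 1) → ℕ) [∀ μ, NeZero (M μ)] (rs : ℕ → (Fin (d + 1) → ℕ)) (n : ℕ) :
    towerGen Lc M rs (n + 1) = Matrix.fromCols
      ((tgradBlock M (bigRatio Lc n)).submatrix
        (fun b : ↥(pbox (towerTorus Lc (fine Lc M) n)) × Fin (d + 1) =>
          ((pboxCongr (towerTorus_fine_eq_fine Lc M n) b.1, Sum.inl b.2) : Idx (fine (bigRatio Lc n) M) (Fib d)))
        (Subtype.val : Res (toSite (rs 0)) Lc M → ↥(pbox M)))
      (towerGen Lc (fine Lc M) (fun k => rs (k + 1)) n) := rfl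

/-- **(B) IS THE CASE `n = 1` ON THE NOSE**: `towerGen … 1 = fromCols D₂ D₁` with (B)'s `hD₂ hD₁` right-hand sides character for character
(`r′ := rs 0`, `r := rs 1`; `pboxCongr` along the `rfl`-equality `fine Lc M = fine Lc M` is the identity by `rfl`). -/
theorem towerGen_one (M : Fin (d + 1) → ℕ) [∀ μ, NeZero (M μ)] (rs : ℕ → (Fin (d + 1) → ℕ)) :
    towerGen Lc M rs 1 = Matrix.fromCols
      ((tgradBlock M Lc).submatrix (fun b : ↥(pbox (fine Lc M)) × Fin (d + 1) => ((b.1, Sum.inl b.2) : Idx (fine Lc M) (Fib d)))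
        (Subtype.val : Res (toSite (rs 0)) Lc M → ↥(pbox M)))
      ((tgrad (fine Lc M)).submatrix (fun b : ↥(pbox (fine Lc M)) × Fin (d + 1) => ((b.1, Sum.inl b.2) : Idx (fine Lc M) (Fib d)))
        (Subtype.val : Res (toSite (rs 1)) Lc (fine Lc M) → ↥(pbox (fine Lc M)))) := rfl

end Generators

end Summit.QuantumFields.BalabanUV.Beta.FP.TorusCompositeObjects

end
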